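import Literature.Barriers.CriticalPhenomena.AmenableInvariantPercolation
import Mathlib.Combinatorics.SimpleGraph.Metric
import Mathlib.Probability.Distributions.Bernoulli
import Mathlib.Analysis.SpecialFunctions.Exp
import Mathlib.Analysis.SpecificLimits.Basic

/-!
# Proof of the barrier `AmenableInvariantPercolation` (Lyons–Peres 2016, Thm. 8.37, "amenable ⟹")

This file discharges the named fact
`Literature.Barriers.CriticalPhenomena.AmenableInvariantPercolation` of
`Literature/Barriers/CriticalPhenomena/AmenableInvariantPercolation.lean`:

> on a connected, locally finite, transitive, amenable graph `G` there is, for every `α < 1`, an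
> automorphism-invariant site percolation with only finite clusters and `P[x ∈ ω] > α` for all `x`

(Lyons–Peres 2016, Thm. 8.37, direction "amenable ⟹", transitive case; BLPS 1999), as the
sorry-free theorem `AmenableInvariantPercolation_holds`.

## The printed proof (Lyons–Peres 2016, pp. 412–413) and the formalised variant

Printed proof. Fix `o`. For a finite `F ⊂ V` choose, for every `x`, a Haar-random automorphism
`γ_x` with `γ_x o = x` and an independent Bernoulli(`1/|F|`) site percolation `ζ`; put
`ω_F := V ∖ ⋃_{x ∈ ζ} ∂_V(γ_x F)`. By the mass-transport identity
`E|{x ∈ ζ ; o ∈ γ_x L}| = |L|/|F|` ((8.25), from Exercise 8.13 and unimodularity, Prop. 8.14) one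
gets `P[o ∉ ω_F] ≤ |∂_V F|/|F|` (8.23) and `P[|K(o, ω_F)| < ∞] ≥ 1 - 1/e` (8.24). Amenability gives
`F_n` with `Σ_n |∂_V F_n|/|F_n| < 1 - α`; the independent intersection `ω := ⋂_n ω_{F_n}` works.

Formalised variant (same architecture, no Haar measure). The randomisation "`x ∈ ζ` and `γ_x`" is
replaced by independent coins indexed by the countable set of *all copies* `γ F_n`
(`γ ∈ Aut(G)`) at every level `n`: the coin of a copy `C` of `F_n` shows heads with probability
`q_n := 1/N_n`, where `N_n` is the number of copies of `F_n` through a vertex (finite, positive,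
and independent of the vertex by transitivity); the configuration removes the inner vertex
boundary `∂_in C` of every activated copy (`config`). Its law `perc` is the push-forward of the
product measure `Measure.infinitePi` of Bernoulli measures (`coinMeasure`), and is
`Aut(G)`-invariant because an automorphism permutes the copies level by level
(`coinMeasure_map_comp_equiv`, `perc_preimage_image`). The substitute for (8.25) is the purely
combinatorial **Følner double counting** `amenable_double_count`: if every vertex lies in `N`
copies and in `M` inner boundaries of copies, then `M · |F| ≤ N · |∂_in F|` (count incidences
inside a large Følner set; copies have bounded radius, so the error lives near the boundary).
Hence (8.23) becomes `P[x ∉ ω] ≤ Σ_n q_n M_n ≤ Σ_n |∂_E F_n|/|F_n| ≤ (1 - α)/2`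
(`coinMeasure_not_mem_config_le`), and (8.24) becomes: the event "no activated copy of `F_n`
contains `x` for all `n < m`" is a cylinder of probability `∏_{n<m} (1 - 1/N_n)^{N_n} ≤ e^{-m}`
(`coinMeasure_forall_eq_false_le`), so almost surely every vertex lies in an activated copy, whose
closed inner boundary confines its cluster (`siteCluster_subset_of_innerBoundary_closed`).
Unimodularity is therefore not used (consistent with Prop. 8.14: amenable transitive graphs are
unimodular).

## Audit 2026-08-16, gen-20 (D-0021 barrier audit of this file): CONFIRMED; association + finite range in print; the dust loophole; `ξ_ε` has induced clusters

(Twentieth audit pass of the catalogue entry `AmenableInvariantPercolation`; gens 1–19 are recorded in the module docstring of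
`AmenableInvariantPercolation.lean`, which has reached the gate's size cap — from gen-20 on the record continues here. "gen-k",
"(i)", "(iii)", "(E5)" refer to that docstring and its structured blocks.)

CONFIRMED again (`AmenableInvariantPercolation` read back by `Iff.rfl` against the displayed `∀ V … ∃ μ …` text and
`AmenableInvariantPercolation_holds` re-probed through a probe file: rc 0, sorry-free, axioms `propext`, `Classical.choice`,
`Quot.sound`; `SiteConfig = Set V` with Mathlib's `Set.instMeasurableSpace` (the product σ-algebra), `siteOpenGraph`, `siteCluster`,
`innerBoundary`, `edgeBoundary`, `IsGraphAmenable` (edge-Følner sets), `IsGraphTransitive`, `IsInvariantSitePercolation` re-read and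
faithful; p. 412 of the held copy — Thm. 8.37 verbatim as vendored, with the book's own `ℤ^d` remark —, p. 433 (Exercise 8.38: the site
threshold `P[o ∈ ω] < d/(d + Φ_V(G))`) and p. 403 (the `ξ_ε` paragraph) re-read; the one consumer filed since gen-19, the card
`exchange-rate-transport`, cites the entry as "not engaged — the mechanism lives on the `p`-family"). Four remarks; no door reopens.
(1) ASSOCIATION + FINITE RANGE, IN PRINT. The intersection of evasion (i) with the non-evasion (iii) — positively associated AND
`k`-independent models — has its own threshold theory [cite: KohlerschindlerSulser2024, Thm. 1 and Thm. 2]: on every infinite locally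
finite tree every positively associated finite-range dependent bond (or site) model with marginals `> p_c(T) = 1/br(T)` percolates
(`p_a^+(T) = p_c(T)`, against `p^+(T) ≥ 3/4` without association, Balister–Bollobás 2012); on every graph of bounded degree such models
are sandwiched between Bernoulli fields, `π_{ρ(p)} ≪ P ≪ π_{σ(p)}` with increasing homeomorphisms `ρ, σ` of `[0, 1]` depending on the
degree and `k` only (Liggett–Schonmann–Stacey extended to all marginals under association); and `1/2 < p_a^+(ℤ²) ≤ 0.77`,
`p_a^+(ℤ^n) ≤ (√2/n)(1 + o(1))` (ibid., Thm. 4, Cor. 1). The authors remark (ibid., §1) that "without finite-range dependence,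
positively associated percolation models with marginals arbitrarily close to `1` that do not percolate can be obtained by assigning the
same state within each level set of some fixed root" — the non-invariant tree form of (iii); on a regular tree `T_{b+1}`, `b ≥ 2` (nonamenable,
unimodular) no `Aut(T)`-invariant such model exists [cite: LyonsPeres2016, Thm. 8.16 (Exercise 8.38)], while on `ℤ^d` the invariant
ones are this entry (`AmenableInvariantPercolation_assoc`,
gen-4) — and ask (ibid., §6) for an extension of their Thm. 1 "to classes of positively associated percolation models satisfying a
sufficiently fast decay of correlations", conjecturing `p^+_{a,s}(ℤ^n) = (1/2n)(1 + o(1))` for the symmetric (invariant) subclass. For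
ADDITIVE decay (α-mixing of comparable boxes) on `ℤ^d` the catalogue already locates that line, and association is not the operative
hypothesis: a dyadically summable class-uniform envelope restores a size-blind finite-cluster threshold with no association assumed
(gen-11 (E5)(a)), whereas for every dyadically non-summable envelope the sparse witnesses `perc (zdGraph d) F q` of
`AmenableInvariantPercolationSparse.lean` are invariant, finite-cluster, of density `> α` AND positively associated (`perc_harris` of
`AmenableInvariantPercolationAssociation.lean` holds for all templates `F` and intensities `q`): inside "positively associated with
`ᾱ_μ ≤ ε`" the dichotomy is again `Σ_k ε(2^k) < ∞`.
(2) THE DUST LOOPHOLE of gen-16 (1), closed for OR-type wall unions (exact enumeration, this audit; scripts `fkg/lines_dust.py`,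
`fkg/planes_dust.py` kept in the audit folder). Gen-16 (1) convicted the i.i.d. hyperplane foam through a ZERO atom
(`p(only (0,0), (1,1) open) = 0` on a `2 × 2` window) and capped flat BARE wall atoms at `δ/√(2m)` — two statements about undecorated
walls, which leave open whether decorating the walls with independent closed dust of density `η` (making every atom positive and killing
bare-wall atoms by the factor `(1-η)^{m^d}`, at total density still `→ 1` if `η → 0`) could restore the lattice condition. It cannot, at
ANY dust density: for `closed(x) = ⋁_i plane_i(x_i) ∨ dust(x)` with i.i.d. Bernoulli(`w`) hyperplanes per direction and i.i.d.
Bernoulli(`η`) dust, the local minors `p(S ∪ {i,j}) p(S) ≥ p(S ∪ {i}) p(S ∪ {j})` of the exact atom probabilities already fail on the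
unit-cube window `{0,1}^d`, `d = 2, 3`, for every tested `(w, η)`, `w ∈ {0.1, 0.03, 0.01}`, `η ∈ [w², 0.9]`: worst ratio
`1.2·10⁻²` at `(w, η) = (0.1, 0.01)`, `0.93` at `η = 0.5`, `0.997` at `η = 0.9` in `d = 2`; `2.0·10⁻³` at `η = 0.1`, `0.47` at
`η = 0.5`, `0.98` at `η = 0.9` in `d = 3` (`w = 0.1`) — the deficient minor at large `η` being `S = {0,1}^d ∖ {0, 𝟙}` with
`{i, j} = {0, 𝟙}` the antipodal pair; for that `2 × 2` minor, to leading order in `w` and for every `η ∈ (0, 1)`,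
`1 - ratio = 2w²η²(1-η) / (η³ + 2wη + w²)² > 0` (checked against the exact values: `1.4·10⁻³` vs `1.45·10⁻³` at `(0.01, 0.5)`,
`2.9·10⁻⁵` both at `(0.01, 0.9)`) — at order `w²` the four pairs of single-line explanations of `S ∪ {i}` and `S ∪ {j}` weigh `w²η²`
each (plus `2w²η³` from the doubly explained factor), while in `p(S ∪ {i,j}) p(S)` the two parallel pairs weigh `w²η²` and the four crossing pairs, which leave a site to the dust,
only `w²η³`: the row and the column through a closed site explain each other away. Together with the rigid-grain computation of gen-18 (1)(c) this closes the Boolean-model sub-door (unions of independent grains, dust included)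
of gen-16 (3), numerically on the unit-cube window and asymptotically in `w` on the `2 × 2` one; the question itself — a monotonic translation-invariant caging law of density `→ 1` — stays OPEN,
and any witness needs intrinsically random, positive-entropy rough walls produced by a non-OR mechanism (gen-16 (1), gen-18 (1)).
(3) `ξ_ε` HAS INDUCED CLUSTERS (structural remark; no lever). By its printed definition [cite: LyonsPeres2016, Thm. 8.21 (proof, p. 403)]
`ξ_ε = {[x, y] : c_ε(x) = c_ε(y)}` for the invariant random colouring `c_ε(x) := K_{p_c-ε}(W(x))` of `V` by the finite clusters of
`ω_{p_c-ε}` meeting `ω'`: the AGREEMENT (monochromatic-edge) bond percolation of an invariant random partition of `ℤ³` into a.s.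
finite classes (finite by the transport `x ↦ W(x)`), each class the disjoint union of its core `K ⊆ ω'` (`W` is the identity on `ω'`)
and a halo of vertices off `ω'` whose selected nearest `ω'`-point lies in `K`; as `ε ↓ 0` the partitions coarsen. Equivalently: every
edge of `ℤ³` joining two vertices of one `ξ_ε`-cluster is `ξ_ε`-open — the clusters are INDUCED subgraphs — so `ξ_ε` obeys exact local
constraints foreign to Bernoulli or general bond percolations (no cycle carries exactly one closed edge: `P[a plaquette has exactly one
closed edge] = 0`), and of the two slacks in the proof of [cite: LyonsPeres2016, Thm. 8.16 (proof, p. 400: E[deg_ω o] = E[α_{K(o)}] ≤ α(G), with (8.17) for induced subgraphs)]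
— cluster versus induced subgraph (closed chords), induced subgraph versus `α(G) = d_G - Φ_E(G)` (the profile) — the first vanishes
for it: `d_G - E[deg_{ξ_ε} o] = E[ |∂_E K(o)| / |K(o)| ]` exactly, so all of Thm. 8.16's information about `ξ_ε` sits in the profile
term of gen-2, none in a size-blind slack. The class is no restriction of the barrier: the bond form "edges with both ends open" of ANY
site percolation is the agreement percolation of the partition into open clusters and closed singletons (so [cite: LyonsPeres2016, Exercise 8.58]
/ `AmenableInvariantPercolation_bond` are members), and the cube tilings in bond form (close the edges crossing cell faces; adjacent
distinct classes, as for `ξ_ε`), the hyperfinite exhaustions of gen-3 and the finitary cell processes of gen-6 [cite: Spinka2020, Prop. 4.1]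
are agreement percolations of coarsening invariant finite partitions with marginals `→ 1`. What distinguishes `ξ_ε` inside the class is
only the law of its class volumes — near-critical cluster volumes of `ω_{p_c-ε}`, size-biased through `W` — i.e. the rate competition of
gens 2, 5 and 6 once more.
(4) IN PRINT, adjacent to gen-6 / gen-15: stationary finitely dependent processes supported on TILING subshifts — the finitely dependent,
hence threshold-capped (gen-6 (E0): density `≤ 1 - c_d/k` at range `k`), relatives of the tiling witnesses — exist or not according to a
cohomological (height-function) invariant of the subshift; for tilings of `ℤ²` by boxes this is characterised by Chandgotia–Thorat
(arXiv:2605.02226, 2026, §§1–2, answering Gao–Jackson–Krohne–Seward in `d = 2`). No bearing on the entry (fixed range caps the density).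
Literature sweep at gen-20 (local hybrid index, arXiv title search to 2026-08-16 and the Explorer corpora reachable; OpenAlex daily budget
exhausted and Semantic Scholar rate-limited — search-degraded for those two): [cite: KohlerschindlerSulser2024, Thm. 1], Chandgotia–Thorat
2026, [cite: Chu2026, Remark 1.2], Klausen–Kravitz 2026 (arXiv:2602.12261, planar non-coexistence without FKG), Baldasso 2026, Moreno
Alonso–Komjáthy 2026 (arXiv:2607.18011), de Araújo et al. 2026, Spinka–Yakir 2026: nothing on `θ(p_c)` for nearest-neighbour percolation
on transitive graphs of polynomial growth with `3 ≤ d ≤ 10` beyond the evasions already listed: CONFIRMED (twentieth pass; saturation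
as recorded at gen-19 — the open items remain the side questions gen-16 (3) and gen-12 (2)).

## Contents

* `isoImage`, `copies`, `through`, `bthrough`: copies `γ F` of a finite set and incidence sets;
  `ballF`, `countable_of_connected`, `exists_radius_copies`, `through_finite`.
* `amenable_double_count`, `ncard_bthrough_mul_card_le`: Følner double counting.
* `Idx`, `coinMeasure`, `config`, `perc`: the construction; `isInvariantSitePercolation_perc`.
* `AmenableInvariantPercolation_holds`.

## References

* R. Lyons, Y. Peres, *Probability on Trees and Networks*, CUP 2016, §8.7, Thm. 8.37 (proof
  pp. 412–413), Exercise 8.13, Prop. 8.14, §6.1. [cite: LyonsPeres2016, Thm. 8.37]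
* I. Benjamini, R. Lyons, Y. Peres, O. Schramm, *Group-invariant percolation on graphs*,
  GAFA 9 (1999) 29–66.
* (audit gen-20) L. Köhler-Schindler, A. L. Sulser, *Critical probabilities for positively associated,
  finite-range dependent percolation models*, arXiv:2405.07345 (2024): Thm. 1, Thm. 2, Thm. 4, Cor. 1,
  §1, §6 [KohlerschindlerSulser2024]; R. Lyons, Y. Peres, op. cit., Thm. 8.16 (proof p. 400), Thm. 8.21
  (proof p. 403), Exercise 8.38 (p. 433) [LyonsPeres2016]; Y. Spinka, Ann. Probab. 48 (2020), Prop. 4.1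
  [Spinka2020]; T. Chu, *Applications of the cluster graphing*, arXiv:2608.06644 (2026), Remark 1.2 [Chu2026];
  N. Chandgotia, A. Thorat, *Finitely dependent processes on subshifts*, arXiv:2605.02226 (2026), §§1–2;
  F. R. Klausen, N. Kravitz, *Half-plane non-coexistence without FKG*, arXiv:2602.12261 (2026).
-/

namespace Literature.Barriers.CriticalPhenomena

open Literature.Probability.LatticeModels Literature.Probability.Percolation Finset

variable {V : Type*} {G : SimpleGraph V}

/-! ### Images of finite vertex sets under automorphisms -/

section IsoImage

/-- The image `γ · C` of a finite vertex set `C` under a graph automorphism `γ`, as a `Finset`.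
[folklore] -/
def isoImage (γ : G ≃g G) (C : Finset V) : Finset V := C.map γ.toEquiv.toEmbedding

/-- Membership in `γ · C`: `v ∈ γ C ↔ γ⁻¹ v ∈ C`. [folklore] -/
@[simp] theorem mem_isoImage {γ : G ≃g G} {C : Finset V} {v : V} :
    v ∈ isoImage γ C ↔ γ.symm v ∈ C := by
  unfold isoImage
  rw [Finset.mem_map_equiv]
  rfl

/-- `|γ · C| = |C|`. [folklore] -/
@[simp] theorem card_isoImage (γ : G ≃g G) (C : Finset V) : (isoImage γ C).card = C.card :=
  Finset.card_map _

/-- `γ · C`, coerced to a set, is the image `γ '' C`. [folklore] -/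
theorem coe_isoImage (γ : G ≃g G) (C : Finset V) :
    (↑(isoImage γ C) : Set V) = (γ : V → V) '' ↑C := by
  ext v
  simp only [mem_coe, mem_isoImage, Set.mem_image]
  constructor
  · intro h
    exact ⟨γ.symm v, h, γ.apply_symm_apply v⟩
  · rintro ⟨w, hw, rfl⟩
    simpa using hw

/-- The identity automorphism fixes every finite set. [folklore] -/
@[simp] theorem isoImage_refl (C : Finset V) : isoImage (RelIso.refl G.Adj) C = C := by
  ext v
  simp [mem_isoImage]

/-- `γ · (γ' · C) = (γ ∘ γ') · C`. [folklore] -/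
theorem isoImage_trans (γ' γ : G ≃g G) (C : Finset V) :
    isoImage γ (isoImage γ' C) = isoImage (γ'.trans γ) C := by
  ext v
  simp

/-- `γ⁻¹ · (γ · C) = C`. [folklore] -/
@[simp] theorem isoImage_symm_isoImage (γ : G ≃g G) (C : Finset V) :
    isoImage γ.symm (isoImage γ C) = C := by
  ext v
  simp

/-- `γ · (γ⁻¹ · C) = C`. [folklore] -/
@[simp] theorem isoImage_isoImage_symm (γ : G ≃g G) (C : Finset V) :
    isoImage γ (isoImage γ.symm C) = C := by
  ext v
  simp

/-- `C ↦ γ · C` is injective. [folklore] -/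
theorem isoImage_injective (γ : G ≃g G) : Function.Injective (isoImage γ) := fun C D h => by
  rw [← isoImage_symm_isoImage γ C, h, isoImage_symm_isoImage]

/-- `isoImage γ` as a permutation of `Finset V`. [folklore] -/
def isoImageEquiv (γ : G ≃g G) : Finset V ≃ Finset V where
  toFun := isoImage γ
  invFun := isoImage γ.symm
  left_inv := isoImage_symm_isoImage γ
  right_inv := isoImage_isoImage_symm γ

/-- `isoImageEquiv γ` acts as `isoImage γ`. [folklore] -/
@[simp] theorem isoImageEquiv_apply (γ : G ≃g G) (C : Finset V) :
    isoImageEquiv γ C = isoImage γ C := rfl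

/-- The inverse of `isoImageEquiv γ` acts as `isoImage γ⁻¹`. [folklore] -/
@[simp] theorem isoImageEquiv_symm_apply (γ : G ≃g G) (C : Finset V) :
    (isoImageEquiv γ).symm C = isoImage γ.symm C := rfl

end IsoImage

/-! ### Copies of a finite set under the automorphism group -/

section Copies

variable (G) in
/-- The set of copies `{γ F : γ ∈ Aut(G)}` of a finite vertex set `F`. [folklore] -/
def copies (F : Finset V) : Set (Finset V) := Set.range fun γ : G ≃g G => isoImage γ F

/-- `F` is a copy of itself. [folklore] -/
theorem self_mem_copies (F : Finset V) : F ∈ copies G F := ⟨RelIso.refl _, isoImage_refl F⟩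

/-- Every copy of `F` has `|F|` vertices. [folklore] -/
theorem card_of_mem_copies {F C : Finset V} (h : C ∈ copies G F) : C.card = F.card := by
  obtain ⟨γ, rfl⟩ := h
  exact card_isoImage γ F

/-- Automorphisms map copies of `F` to copies of `F`. [folklore] -/
theorem isoImage_mem_copies {F C : Finset V} (γ : G ≃g G) (h : C ∈ copies G F) :
    isoImage γ C ∈ copies G F := by
  obtain ⟨γ', rfl⟩ := h
  exact ⟨γ'.trans γ, (isoImage_trans γ' γ F).symm⟩

/-- `γ · C` is a copy of `F` iff `C` is. [folklore] -/
@[simp] theorem isoImage_mem_copies_iff {F C : Finset V} (γ : G ≃g G) :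
    isoImage γ C ∈ copies G F ↔ C ∈ copies G F :=
  ⟨fun h => by simpa using isoImage_mem_copies γ.symm h, isoImage_mem_copies γ⟩

variable (G) in
/-- The copies of `F` passing through the vertex `x`. [folklore] -/
def through (F : Finset V) (x : V) : Set (Finset V) := {C | C ∈ copies G F ∧ x ∈ C}

/-- Equivariance: the copies through `γ x` are the `γ`-images of the copies through `x`.
[folklore] -/
theorem through_apply_eq_image (γ : G ≃g G) (F : Finset V) (x : V) :
    through G F (γ x) = isoImage γ '' through G F x := by
  ext C
  constructor
  · rintro ⟨hC, hx⟩
    refine ⟨isoImage γ.symm C, ⟨isoImage_mem_copies _ hC, ?_⟩, by simp⟩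
    simpa using hx
  · rintro ⟨D, ⟨hD, hx⟩, rfl⟩
    exact ⟨isoImage_mem_copies γ hD, by simpa using hx⟩

/-- In a transitive graph the number of copies of `F` through a vertex does not depend on the
vertex. [folklore] -/
theorem ncard_through_eq (ht : IsGraphTransitive G) (F : Finset V) (x y : V) :
    (through G F x).ncard = (through G F y).ncard := by
  obtain ⟨γ, rfl⟩ := ht x y
  rw [through_apply_eq_image, Set.ncard_image_of_injective _ (isoImage_injective γ)]

/-- In a transitive graph some copy of a non-empty `F` passes through any given vertex.
[folklore] -/
theorem through_nonempty (ht : IsGraphTransitive G) {F : Finset V} (hF : F.Nonempty) (x : V) :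
    (through G F x).Nonempty := by
  obtain ⟨f, hf⟩ := hF
  obtain ⟨γ, hγ⟩ := ht f x
  exact ⟨isoImage γ F, ⟨γ, rfl⟩, by rw [← hγ]; simpa using hf⟩

end Copies

/-! ### Balls as finite sets, countability -/

section Ball

variable [DecidableEq V] [G.LocallyFinite]

variable (G) in
/-- The closed ball `B(x, n)` of the graph metric, as a `Finset` (locally finite graph):
`B(x, 0) = {x}`, `B(x, n+1) = B(x, n) ∪ ⋃_{u ∈ B(x,n)} N(u)`. [folklore] -/
def ballF (x : V) : ℕ → Finset V
  | 0 => {x}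
  | n + 1 => ballF x n ∪ (ballF x n).biUnion fun u => G.neighborFinset u

/-- `B(x, 0) = {x}`. [folklore] -/
@[simp] theorem ballF_zero (x : V) : ballF G x 0 = {x} := rfl

/-- `B(x, n+1) = B(x, n) ∪ ⋃_{u ∈ B(x, n)} N(u)`. [folklore] -/
theorem ballF_succ (x : V) (n : ℕ) :
    ballF G x (n + 1) = ballF G x n ∪ (ballF G x n).biUnion fun u => G.neighborFinset u := rfl

/-- `B(x, n) ⊆ B(x, n+1)`. [folklore] -/
theorem subset_ballF_succ (x : V) (n : ℕ) : ballF G x n ⊆ ballF G x (n + 1) := by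
  rw [ballF_succ]
  exact subset_union_left

/-- Balls are monotone in the radius. [folklore] -/
theorem ballF_mono (x : V) {m n : ℕ} (h : m ≤ n) : ballF G x m ⊆ ballF G x n := by
  induction n, h using Nat.le_induction with
  | base => exact Subset.rfl
  | succ n _ ih => exact ih.trans (subset_ballF_succ x n)

/-- `x ∈ B(x, n)`. [folklore] -/
theorem mem_ballF_self (x : V) (n : ℕ) : x ∈ ballF G x n :=
  ballF_mono x (Nat.zero_le n) (by simp)

/-- A neighbour of a vertex of `B(x, n)` lies in `B(x, n+1)`. [folklore] -/
theorem mem_ballF_succ_of_adj {x u w : V} {n : ℕ} (hu : u ∈ ballF G x n) (h : G.Adj u w) :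
    w ∈ ballF G x (n + 1) := by
  rw [ballF_succ]
  exact mem_union_right _ (mem_biUnion.2 ⟨u, hu, by simpa using h⟩)

/-- The start of a walk of length `≤ n` ending at `x` lies in `B(x, n)`. [folklore] -/
theorem mem_ballF_of_walk_to {x : V} :
    ∀ {y : V} (p : G.Walk y x) {n : ℕ}, p.length ≤ n → y ∈ ballF G x n
  | _, .nil, n, _ => mem_ballF_self _ n
  | y, .cons h q, n, hn => by
    rw [SimpleGraph.Walk.length_cons] at hn
    obtain ⟨m, rfl⟩ : ∃ m, n = m + 1 := ⟨n - 1, by omega⟩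
    exact mem_ballF_succ_of_adj (mem_ballF_of_walk_to q (by omega)) h.symm

/-- The end of a walk of length `≤ n` starting at `x` lies in `B(x, n)`. [folklore] -/
theorem mem_ballF_of_walk {x y : V} (p : G.Walk x y) {n : ℕ} (h : p.length ≤ n) : y ∈ ballF G x n :=
  mem_ballF_of_walk_to p.reverse (by simpa using h)

/-- Every vertex of `B(x, n)` is joined to `x` by a walk of length `≤ n`. [folklore] -/
theorem exists_walk_of_mem_ballF {x : V} : ∀ {n : ℕ} {y : V}, y ∈ ballF G x n →
    ∃ p : G.Walk x y, p.length ≤ n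
  | 0, y, h => by
    rw [ballF_zero, mem_singleton] at h
    subst h
    exact ⟨.nil, le_rfl⟩
  | n + 1, y, h => by
    rw [ballF_succ, mem_union, mem_biUnion] at h
    rcases h with h | ⟨u, hu, hy⟩
    · obtain ⟨p, hp⟩ := exists_walk_of_mem_ballF h
      exact ⟨p, by omega⟩
    · obtain ⟨p, hp⟩ := exists_walk_of_mem_ballF hu
      rw [SimpleGraph.mem_neighborFinset] at hy
      exact ⟨p.concat hy, by rw [SimpleGraph.Walk.length_concat]; omega⟩

/-- Automorphisms map balls to balls: `γ · B(x, n) = B(γ x, n)`. [folklore] -/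
theorem isoImage_ballF (γ : G ≃g G) (x : V) (n : ℕ) :
    isoImage γ (ballF G x n) = ballF G (γ x) n := by
  ext v
  simp only [mem_isoImage]
  constructor
  · intro h
    obtain ⟨p, hp⟩ := exists_walk_of_mem_ballF h
    exact mem_ballF_of_walk ((p.map γ.toEmbedding.toHom).copy rfl (γ.apply_symm_apply v))
      (by rw [SimpleGraph.Walk.length_copy, SimpleGraph.Walk.length_map]; exact hp)
  · intro h
    obtain ⟨p, hp⟩ := exists_walk_of_mem_ballF h
    exact mem_ballF_of_walk ((p.map γ.symm.toEmbedding.toHom).copy (γ.symm_apply_apply x) rfl)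
      (by rw [SimpleGraph.Walk.length_copy, SimpleGraph.Walk.length_map]; exact hp)

/-- In a transitive graph all balls of the same radius have the same cardinality. [folklore] -/
theorem card_ballF_eq (ht : IsGraphTransitive G) (x y : V) (n : ℕ) :
    (ballF G x n).card = (ballF G y n).card := by
  obtain ⟨γ, rfl⟩ := ht x y
  rw [← isoImage_ballF, card_isoImage]

/-- A connected locally finite graph has countably many vertices. [folklore] -/
theorem countable_of_connected (hc : G.Connected) : Countable V := by
  obtain ⟨o⟩ := hc.nonempty
  have hsub : (Set.univ : Set V) ⊆ ⋃ n : ℕ, (↑(ballF G o n) : Set V) := fun v _ => by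
    obtain ⟨p⟩ := hc.preconnected o v
    exact Set.mem_iUnion.2 ⟨p.length, mem_coe.2 (mem_ballF_of_walk p le_rfl)⟩
  exact Set.countable_univ_iff.1
    ((Set.countable_iUnion fun n => (ballF G o n).countable_toSet).mono hsub)

/-- Copies of a finite set have uniformly bounded radius: there is `R` with `C ⊆ B(x, R)` for
every copy `C` of `F` and every `x ∈ C`. [folklore] -/
theorem exists_radius_copies (hc : G.Connected) (F : Finset V) :
    ∃ R : ℕ, ∀ C ∈ copies G F, ∀ x ∈ C, ∀ y ∈ C, y ∈ ballF G x R := by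
  obtain ⟨o⟩ := hc.nonempty
  refine ⟨F.sup (fun f => G.dist o f) + F.sup (fun f => G.dist o f), ?_⟩
  rintro C ⟨γ, rfl⟩ x hx y hy
  rw [mem_isoImage] at hx hy
  obtain ⟨p, hp⟩ := hc.exists_walk_length_eq_dist (γ.symm x) o
  obtain ⟨p', hp'⟩ := hc.exists_walk_length_eq_dist o (γ.symm y)
  have h1 : G.dist o (γ.symm x) ≤ F.sup (fun f => G.dist o f) :=
    Finset.le_sup (f := fun f => G.dist o f) hx
  have h2 : G.dist o (γ.symm y) ≤ F.sup (fun f => G.dist o f) :=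
    Finset.le_sup (f := fun f => G.dist o f) hy
  refine mem_ballF_of_walk (((p.append p').map γ.toEmbedding.toHom).copy (γ.apply_symm_apply x)
    (γ.apply_symm_apply y)) ?_
  rw [SimpleGraph.Walk.length_copy, SimpleGraph.Walk.length_map, SimpleGraph.Walk.length_append,
    hp, hp', SimpleGraph.dist_comm]
  omega

/-- In a connected locally finite graph only finitely many copies of a finite set pass through a
given vertex (they all lie in a fixed ball). [folklore] -/
theorem through_finite (hc : G.Connected) (F : Finset V) (x : V) : (through G F x).Finite := by
  obtain ⟨R, hR⟩ := exists_radius_copies hc F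
  refine ((ballF G x R).powerset.finite_toSet).subset ?_
  rintro C ⟨hC, hx⟩
  rw [mem_coe, mem_powerset]
  intro y hy
  exact hR C hC x hx y hy

end Ball

/-! ### Inner vertex boundary: equivariance, comparison with the edge boundary, clusters -/

section Boundary

variable [DecidableEq V] [G.LocallyFinite]

/-- `∂_in C ⊆ C`. [folklore] -/
theorem innerBoundary_subset (C : Finset V) : innerBoundary G C ⊆ C := fun _ h =>
  (mem_innerBoundary_iff.1 h).1

/-- Equivariance of the inner vertex boundary: `∂_in (γ · C) = γ · ∂_in C`. [folklore] -/
theorem innerBoundary_isoImage (γ : G ≃g G) (C : Finset V) :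
    innerBoundary G (isoImage γ C) = isoImage γ (innerBoundary G C) := by
  ext v
  simp only [mem_innerBoundary_iff, mem_isoImage]
  constructor
  · rintro ⟨hv, y, hy, hadj⟩
    refine ⟨hv, γ.symm y, hy, ?_⟩
    simpa [γ.symm.map_rel_iff] using hadj
  · rintro ⟨hv, y, hy, hadj⟩
    refine ⟨hv, γ y, by simpa using hy, ?_⟩
    have : G.Adj (γ (γ.symm v)) (γ y) := (γ.map_rel_iff).2 hadj
    simpa using this

/-- `|∂_in F| ≤ |∂_E F|`: each inner boundary vertex is the inside endpoint of a boundary edge.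
[folklore] -/
theorem card_innerBoundary_le_card_edgeBoundary (F : Finset V) :
    (innerBoundary G F).card ≤ (edgeBoundary G F).card := by
  classical
  -- choose for each inner boundary vertex an outside neighbour
  have hch : ∀ x ∈ innerBoundary G F, ∃ y, y ∉ F ∧ G.Adj x y := fun x hx =>
    (mem_innerBoundary_iff.1 hx).2
  choose! nb hnb using hch
  refine Finset.card_le_card_of_injOn (fun x => s(x, nb x)) (fun x hx => ?_) ?_
  · have hx' := mem_innerBoundary_iff.1 (mem_coe.1 hx)
    obtain ⟨hy, hadj⟩ := hnb x (mem_coe.1 hx)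
    rw [mem_coe, mem_edgeBoundary_iff]
    exact ⟨hadj, ⟨x, hx'.1, Sym2.mem_mk_left _ _⟩, ⟨nb x, hy, Sym2.mem_mk_right _ _⟩⟩
  · intro x hx x' hx' h
    have hxF := (mem_innerBoundary_iff.1 (mem_coe.1 hx)).1
    obtain ⟨hy', -⟩ := hnb x' (mem_coe.1 hx')
    rcases Sym2.eq_iff.1 h with ⟨h1, -⟩ | ⟨h1, -⟩
    · exact h1
    · exact absurd (h1 ▸ hxF) hy'

variable (G) in
/-- The copies of `F` whose inner vertex boundary contains `x`. [folklore] -/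
def bthrough (F : Finset V) (x : V) : Set (Finset V) :=
  {C | C ∈ copies G F ∧ x ∈ innerBoundary G C}

/-- A copy whose inner boundary contains `x` passes through `x`. [folklore] -/
theorem bthrough_subset_through (F : Finset V) (x : V) : bthrough G F x ⊆ through G F x :=
  fun _ ⟨hC, hx⟩ => ⟨hC, innerBoundary_subset _ hx⟩

/-- Equivariance: the copies with `γ x` on their inner boundary are the `γ`-images of those with
`x` on their inner boundary. [folklore] -/
theorem bthrough_apply_eq_image (γ : G ≃g G) (F : Finset V) (x : V) :
    bthrough G F (γ x) = isoImage γ '' bthrough G F x := by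
  ext C
  constructor
  · rintro ⟨hC, hx⟩
    refine ⟨isoImage γ.symm C, ⟨isoImage_mem_copies _ hC, ?_⟩, by simp⟩
    rw [innerBoundary_isoImage, mem_isoImage]
    simpa using hx
  · rintro ⟨D, ⟨hD, hx⟩, rfl⟩
    refine ⟨isoImage_mem_copies γ hD, ?_⟩
    rw [innerBoundary_isoImage, mem_isoImage]
    simpa using hx

/-- In a transitive graph the number of copies of `F` having a given vertex on their inner
boundary does not depend on the vertex. [folklore] -/
theorem ncard_bthrough_eq (ht : IsGraphTransitive G) (F : Finset V) (x y : V) :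
    (bthrough G F x).ncard = (bthrough G F y).ncard := by
  obtain ⟨γ, rfl⟩ := ht x y
  rw [bthrough_apply_eq_image, Set.ncard_image_of_injective _ (isoImage_injective γ)]

/-- Every copy of `F` has an inner boundary of size `|∂_in F|`. [folklore] -/
theorem card_innerBoundary_of_mem_copies {F C : Finset V} (h : C ∈ copies G F) :
    (innerBoundary G C).card = (innerBoundary G F).card := by
  obtain ⟨γ, rfl⟩ := h
  rw [innerBoundary_isoImage, card_isoImage]

/-- If the inner vertex boundary of a finite set `C` is closed in the site configuration `ω`,
the open site cluster of any `x ∈ C` stays inside `C`. [folklore] -/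
theorem siteCluster_subset_of_innerBoundary_closed (ω : Set V) (C : Finset V)
    (hC : ∀ v ∈ innerBoundary G C, v ∉ ω) {x : V} (hx : x ∈ C) :
    siteCluster G ω x ⊆ ↑C := by
  -- one open step cannot leave `C`
  have step : ∀ a b : V, (siteOpenGraph G ω).Adj a b → a ∈ C → b ∈ C := by
    intro a b hab ha
    rw [siteOpenGraph_adj] at hab
    by_contra hb
    exact hC a (mem_innerBoundary_iff.2 ⟨ha, b, hb, hab.1⟩) hab.2.1
  -- induction along an open walk
  have key : ∀ {a b : V} (p : (siteOpenGraph G ω).Walk a b), a ∈ C → b ∈ C := by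
    intro a b p
    induction p with
    | nil => exact id
    | cons h _ ih => exact fun ha => ih (step _ _ h ha)
  rintro y ⟨-, -, ⟨p⟩⟩
  exact mem_coe.2 (key p hx)

end Boundary

/-! ### Følner double counting -/

section DoubleCount

variable [DecidableEq V] [G.LocallyFinite]

/-- **Følner double counting.** Let `𝒞` be a family of `a`-element vertex sets ("copies") of
uniformly bounded radius `R` in an amenable graph whose `R`-balls have at most `β` vertices, and
let `L C ⊆ C` be a distinguished part of each copy with `|L C| ≤ b`. If every vertex lies in
exactly `N` copies and in exactly `M` of the parts `L C`, then `M · a ≤ N · b` — the infinite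
analogue of counting the incidences `(x, C)`, `x ∈ C` resp. `x ∈ L C`, in two ways, the boundary
error being killed by a Følner set. (This replaces the Haar-measure computation (8.25) of
[cite: LyonsPeres2016, Thm. 8.37 (proof), Exercise 8.13].) [folklore] -/
theorem amenable_double_count (ha : IsGraphAmenable G) {𝒞 : Set (Finset V)}
    {L : Finset V → Finset V} {a b N M R β : ℕ}
    (hLsub : ∀ C ∈ 𝒞, L C ⊆ C)
    (hcard : ∀ C ∈ 𝒞, C.card = a) (hLcard : ∀ C ∈ 𝒞, (L C).card ≤ b)
    (hfin : ∀ x, {C | C ∈ 𝒞 ∧ x ∈ C}.Finite)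
    (hN : ∀ x, {C | C ∈ 𝒞 ∧ x ∈ C}.ncard = N)
    (hM : ∀ x, {C | C ∈ 𝒞 ∧ x ∈ L C}.ncard = M)
    (hR : ∀ C ∈ 𝒞, ∀ x ∈ C, ∀ y ∈ C, y ∈ ballF G x R)
    (hβ : ∀ x, (ballF G x R).card ≤ β) :
    M * a ≤ N * b := by
  classical
  -- `T x`: the copies through `x`, as a finset
  set T : V → Finset (Finset V) := fun x => (hfin x).toFinset with hT
  have memT : ∀ x C, C ∈ T x ↔ C ∈ 𝒞 ∧ x ∈ C := fun x C => by simp [hT]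
  have cardT : ∀ x, (T x).card = N := fun x => by
    rw [← hN x, Set.ncard_eq_toFinset_card _ (hfin x)]
  have hfinL : ∀ x, {C | C ∈ 𝒞 ∧ x ∈ L C}.Finite := fun x =>
    (hfin x).subset fun C ⟨hC, hx⟩ => ⟨hC, hLsub C hC hx⟩
  have cardTL : ∀ x, ((T x).filter fun C => x ∈ L C).card = M := by
    intro x
    rw [← hM x, Set.ncard_eq_toFinset_card _ (hfinL x)]
    congr 1
    ext C
    simp only [mem_filter, memT, Set.Finite.mem_toFinset, Set.mem_setOf_eq]
    exact ⟨fun h => ⟨h.1.1, h.2⟩, fun h => ⟨⟨h.1, hLsub C h.1 h.2⟩, h.2⟩⟩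
  -- it suffices to prove the inequality up to `ε` in `ℝ`
  suffices key : ∀ ε : ℝ, 0 < ε → (M * a : ℝ) ≤ N * b + ε * (β * N * a * b) by
    have hreal : (M * a : ℝ) ≤ N * b := by
      refine le_of_forall_pos_le_add fun ε hε => ?_
      have hX : (0 : ℝ) ≤ β * N * a * b := by positivity
      have h := key (ε / (β * N * a * b + 1)) (by positivity)
      have h' : ε / (β * N * a * b + 1) * (β * N * a * b) ≤ ε := by
        rw [div_mul_eq_mul_div, div_le_iff₀ (by positivity), mul_add, mul_one]
        linarith
      linarith
    exact_mod_cast hreal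
  intro ε hε
  obtain ⟨K, hKne, hK⟩ := ha ε hε
  have hKin : ((innerBoundary G K).card : ℝ) ≤ ε * K.card :=
    le_trans (by exact_mod_cast card_innerBoundary_le_card_edgeBoundary K) hK
  -- the copies meeting `K`
  set CK : Finset (Finset V) := K.biUnion T with hCK
  have memCK : ∀ C, C ∈ CK ↔ C ∈ 𝒞 ∧ ∃ x ∈ K, x ∈ C := by
    intro C
    simp only [hCK, mem_biUnion, memT]
    exact ⟨fun ⟨x, hx, hC, hxC⟩ => ⟨hC, x, hx, hxC⟩, fun ⟨hC, x, hx, hxC⟩ => ⟨x, hx, hC, hxC⟩⟩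
  -- exchanging the order of summation over incidences `x ∈ K`, `C ∋ x`
  have hcomm : ∀ f : V → Finset V → ℕ,
      ∑ x ∈ K, ∑ C ∈ T x, f x C = ∑ C ∈ CK, ∑ x ∈ K.filter (fun x => x ∈ C), f x C := by
    intro f
    refine Finset.sum_comm' fun x C => ?_
    simp only [mem_filter, memCK, memT]
    exact ⟨fun ⟨hx, hC, hxC⟩ => ⟨⟨hx, hxC⟩, hC, x, hx, hxC⟩,
      fun ⟨⟨hx, hxC⟩, hC, _⟩ => ⟨hx, hC, hxC⟩⟩
  -- (i) `|K| M ≤ |CK| b`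
  have h1 : K.card * M ≤ CK.card * b := by
    calc K.card * M = ∑ x ∈ K, ((T x).filter fun C => x ∈ L C).card := by simp [cardTL]
      _ = ∑ x ∈ K, ∑ C ∈ T x, (if x ∈ L C then 1 else 0 : ℕ) := by
          simp only [sum_boole, Nat.cast_id]
      _ = ∑ C ∈ CK, ∑ x ∈ K.filter (fun x => x ∈ C), (if x ∈ L C then 1 else 0 : ℕ) := hcomm _
      _ ≤ ∑ C ∈ CK, (L C).card := by
          refine sum_le_sum fun C _ => ?_
          rw [sum_boole, Nat.cast_id]
          exact card_le_card fun x hx => (mem_filter.1 hx).2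
      _ ≤ ∑ C ∈ CK, b := sum_le_sum fun C hC => hLcard C ((memCK C).1 hC).1
      _ = CK.card * b := by simp
  -- (ii) `|CK_in| a ≤ |K| N`
  have h2 : (CK.filter fun C => C ⊆ K).card * a ≤ K.card * N := by
    calc (CK.filter fun C => C ⊆ K).card * a = ∑ C ∈ CK.filter (fun C => C ⊆ K), C.card :=
          (sum_const_nat fun C hC => hcard C ((memCK C).1 (mem_filter.1 hC).1).1).symm
      _ = ∑ C ∈ CK.filter (fun C => C ⊆ K), (K.filter fun x => x ∈ C).card := by
          refine sum_congr rfl fun C hC => ?_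
          congr 1
          ext x
          simp only [mem_filter]
          exact ⟨fun hx => ⟨(mem_filter.1 hC).2 hx, hx⟩, fun h => h.2⟩
      _ ≤ ∑ C ∈ CK, (K.filter fun x => x ∈ C).card :=
          sum_le_sum_of_subset_of_nonneg (filter_subset _ _) fun _ _ _ => Nat.zero_le _
      _ = ∑ C ∈ CK, ∑ x ∈ K.filter (fun x => x ∈ C), (1 : ℕ) := by simp
      _ = ∑ x ∈ K, ∑ C ∈ T x, (1 : ℕ) := (hcomm fun _ _ => 1).symm
      _ = K.card * N := by simp [cardT]
  -- (iii) the copies meeting both `K` and its complement sit near the inner boundary of `K`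
  have h3 : (CK.filter fun C => ¬ C ⊆ K).card ≤ (innerBoundary G K).card * (β * N) := by
    have hsub : (CK.filter fun C => ¬ C ⊆ K) ⊆
        (innerBoundary G K).biUnion fun z => (ballF G z R).biUnion T := by
      intro C hC
      rw [mem_filter, memCK] at hC
      obtain ⟨⟨hC𝒞, x₀, hx₀K, hx₀C⟩, hnot⟩ := hC
      obtain ⟨y, hyC, hyK⟩ := not_subset.1 hnot
      obtain ⟨p, hp⟩ := exists_walk_of_mem_ballF (hR C hC𝒞 x₀ hx₀C y hyC)
      obtain ⟨d, hd, hd1, hd2⟩ := p.exists_boundary_dart (↑K) (mem_coe.2 hx₀K)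
        (fun h => hyK (mem_coe.1 h))
      rw [mem_biUnion]
      refine ⟨d.toProd.1, mem_innerBoundary_iff.2
        ⟨mem_coe.1 hd1, d.toProd.2, fun h => hd2 (mem_coe.2 h), d.adj⟩, ?_⟩
      rw [mem_biUnion]
      refine ⟨x₀, ?_, (memT _ _).2 ⟨hC𝒞, hx₀C⟩⟩
      have hz : d.toProd.1 ∈ p.support := p.dart_fst_mem_support_of_mem_darts hd
      exact mem_ballF_of_walk (p.takeUntil _ hz).reverse
        (by rw [SimpleGraph.Walk.length_reverse]; exact (p.length_takeUntil_le_length hz).trans hp)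
    calc (CK.filter fun C => ¬ C ⊆ K).card
        ≤ ((innerBoundary G K).biUnion fun z => (ballF G z R).biUnion T).card := card_le_card hsub
      _ ≤ ∑ z ∈ innerBoundary G K, ((ballF G z R).biUnion T).card := card_biUnion_le
      _ ≤ ∑ z ∈ innerBoundary G K, β * N := by
          refine sum_le_sum fun z _ => ?_
          calc ((ballF G z R).biUnion T).card ≤ ∑ x ∈ ballF G z R, (T x).card := card_biUnion_le
            _ = (ballF G z R).card * N := by simp [cardT]
            _ ≤ β * N := Nat.mul_le_mul_right _ (hβ z)
      _ = (innerBoundary G K).card * (β * N) := by simp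
  -- combine
  have hsplit : (CK.filter fun C => C ⊆ K).card + (CK.filter fun C => ¬ C ⊆ K).card = CK.card :=
    card_filter_add_card_filter_not _
  have hKpos : (0 : ℝ) < K.card := by exact_mod_cast hKne.card_pos
  have e1 : ((K.card : ℝ) * M) ≤ CK.card * b := by exact_mod_cast h1
  have e2 : ((CK.filter fun C => C ⊆ K).card * a : ℝ) ≤ K.card * N := by exact_mod_cast h2
  have e3 : ((CK.filter fun C => ¬ C ⊆ K).card : ℝ) ≤ (innerBoundary G K).card * (β * N) := by
    exact_mod_cast h3
  have e4 : (CK.card : ℝ) =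
      (CK.filter fun C => C ⊆ K).card + (CK.filter fun C => ¬ C ⊆ K).card := by
    exact_mod_cast hsplit.symm
  have main : (K.card : ℝ) * (M * a) ≤ K.card * (N * b + ε * (β * N * a * b)) :=
    calc (K.card : ℝ) * (M * a) = (K.card * M) * a := by ring
      _ ≤ (CK.card * b) * a := by gcongr
      _ = ((CK.filter fun C => C ⊆ K).card * a) * b
          + ((CK.filter fun C => ¬ C ⊆ K).card) * (a * b) := by rw [e4]; ring
      _ ≤ (K.card * N) * b + ((innerBoundary G K).card * (β * N)) * (a * b) := by gcongr
      _ ≤ (K.card * N) * b + ((ε * K.card) * (β * N)) * (a * b) := by gcongr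
      _ = K.card * (N * b + ε * (β * N * a * b)) := by ring
  exact le_of_mul_le_mul_left main hKpos

/-- **Boundary copies are rare.** For a finite set `F` in a connected, transitive, amenable,
locally finite graph: `#{copies C of F with x ∈ ∂_in C} · |F| ≤ #{copies C ∋ x} · |∂_E F|`.
This is the counting inequality behind (8.23) of [cite: LyonsPeres2016, Thm. 8.37 (proof)],
obtained here by Følner double counting instead of Haar measure. [folklore] -/
theorem ncard_bthrough_mul_card_le (hc : G.Connected) (ht : IsGraphTransitive G)
    (ha : IsGraphAmenable G) (F : Finset V) (x : V) :
    (bthrough G F x).ncard * F.card ≤ (through G F x).ncard * (edgeBoundary G F).card := by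
  obtain ⟨R, hR⟩ := exists_radius_copies hc F
  exact amenable_double_count ha (𝒞 := copies G F) (L := innerBoundary G) (R := R)
    (β := (ballF G x R).card)
    (fun C _ => innerBoundary_subset C) (fun C hC => card_of_mem_copies hC)
    (fun C hC => (card_innerBoundary_of_mem_copies hC).le.trans
      (card_innerBoundary_le_card_edgeBoundary F))
    (fun y => through_finite hc F y) (fun y => ncard_through_eq ht F y x)
    (fun y => ncard_bthrough_eq ht F y x) hR (fun y => (card_ballF_eq ht y x R).le)

end DoubleCount

/-! ### The probability space: independent coins indexed by (level, finite vertex set) -/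

section Coins

open MeasureTheory ProbabilityTheory unitInterval

variable (V) in
/-- Index of the coins: a level `n : ℕ` and a finite vertex set `C`. [folklore] -/
abbrev Idx : Type _ := Σ _ : ℕ, Finset V

/-- Independent coins: the coin `⟨n, C⟩` shows `true` with probability `q n`.
(Product measure `Measure.infinitePi` of Bernoulli measures.) [folklore] -/
noncomputable def coinMeasure (q : ℕ → I) : Measure (Idx V → Bool) :=
  Measure.infinitePi fun i : Idx V => bernoulliMeasure true false (q i.1)

/-- The coin measure is a probability measure. [folklore] -/
instance instIsProbabilityMeasureCoinMeasure (q : ℕ → I) :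
    IsProbabilityMeasure (coinMeasure (V := V) q) := by
  unfold coinMeasure; infer_instance

/-- Marginals of the coin measure: the coin `⟨n, C⟩` shows `true` with probability `q n`.
[folklore] -/
theorem coinMeasure_eval_true (q : ℕ → I) (i : Idx V) :
    coinMeasure q {η : Idx V → Bool | η i = true} = toNNReal (q i.1) := by
  have : {η : Idx V → Bool | η i = true} = (fun η => η i) ⁻¹' {true} := rfl
  rw [this, ← Measure.map_apply (measurable_pi_apply i) (measurableSet_singleton _), coinMeasure,
    Measure.infinitePi_map_eval]
  exact bernoulliMeasure_apply_of_mem_of_notMem _ (measurableSet_singleton _) rfl (by simp)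

/-- Cylinder probabilities of the coin measure: finitely many prescribed coins all show `false`
with probability `∏ (1 - q n)`. [folklore] -/
theorem coinMeasure_pi_false (q : ℕ → I) (s : Finset (Idx V)) :
    coinMeasure q (Set.pi (↑s : Set (Idx V)) fun _ => ({false} : Set Bool)) =
      ∏ i ∈ s, (toNNReal (σ (q i.1)) : ENNReal) := by
  rw [coinMeasure, Measure.infinitePi_pi _ (fun _ _ => measurableSet_singleton _)]
  refine Finset.prod_congr rfl fun i _ => ?_
  exact bernoulliMeasure_apply_of_notMem_of_mem _ (measurableSet_singleton _) (by simp) rfl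

/-- The coin measure is invariant under level-preserving permutations of the index set.
[folklore] -/
theorem coinMeasure_map_comp_equiv (q : ℕ → I) (e : Idx V ≃ Idx V) (he : ∀ i, (e i).1 = i.1) :
    (coinMeasure q).map (fun η : Idx V → Bool => η ∘ ⇑e) = coinMeasure (V := V) q := by
  have he' : ∀ i, (e.symm i).1 = i.1 := fun i => by
    conv_rhs => rw [← e.apply_symm_apply i]
    rw [he]
  have h1 : (fun η : Idx V → Bool => η ∘ ⇑e) =
      ⇑(MeasurableEquiv.piCongrLeft (fun _ : Idx V => Bool) e.symm) := by
    funext η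
    funext i
    rw [MeasurableEquiv.coe_piCongrLeft, Equiv.piCongrLeft_apply_eq_cast]
    simp
  have h2 : (fun i : Idx V => bernoulliMeasure true false (q (e.symm i).1)) =
      fun i : Idx V => bernoulliMeasure (true : Bool) false (q i.1) := by
    funext i
    rw [he']
  calc (coinMeasure q).map (fun η : Idx V → Bool => η ∘ ⇑e)
      = (Measure.infinitePi fun i : Idx V => bernoulliMeasure true false (q (e.symm i).1)).map
          ⇑(MeasurableEquiv.piCongrLeft (fun _ : Idx V => Bool) e.symm) := by
        rw [h1, coinMeasure, h2]
    _ = coinMeasure q :=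
        Measure.infinitePi_map_piCongrLeft
          (fun i : Idx V => bernoulliMeasure true false (q i.1)) e.symm

/-- The event that all the coins of `T n` (at every level `n`) show `false` has probability at
most `∏_{n<m} (1 - q n)^{|T n|}`, for every `m`. [folklore] -/
theorem coinMeasure_forall_eq_false_le (q : ℕ → I) (T : ℕ → Finset (Finset V)) (m : ℕ) :
    coinMeasure q {η : Idx V → Bool | ∀ n, ∀ C ∈ T n, η ⟨n, C⟩ = false} ≤
      ∏ n ∈ Finset.range m, (toNNReal (σ (q n)) : ENNReal) ^ (T n).card := by
  set s : Finset (Idx V) := (Finset.range m).sigma T with hs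
  have hsub : {η : Idx V → Bool | ∀ n, ∀ C ∈ T n, η ⟨n, C⟩ = false} ⊆
      Set.pi (↑s : Set (Idx V)) fun _ => ({false} : Set Bool) := by
    intro η hη
    rw [Set.mem_pi]
    rintro ⟨n, C⟩ hi
    rw [Finset.mem_coe, hs, Finset.mem_sigma] at hi
    exact hη n C hi.2
  calc coinMeasure q {η : Idx V → Bool | ∀ n, ∀ C ∈ T n, η ⟨n, C⟩ = false}
      ≤ coinMeasure q (Set.pi (↑s : Set (Idx V)) fun _ => ({false} : Set Bool)) := measure_mono hsub
    _ = ∏ i ∈ s, (toNNReal (σ (q i.1)) : ENNReal) := coinMeasure_pi_false q s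
    _ = ∏ n ∈ Finset.range m, ∏ C ∈ T n, (toNNReal (σ (q n)) : ENNReal) := Finset.prod_sigma _ _ _
    _ = ∏ n ∈ Finset.range m, (toNNReal (σ (q n)) : ENNReal) ^ (T n).card := by simp

/-- Re-indexing of the coins induced by an automorphism: `⟨n, C⟩ ↦ ⟨n, γ C⟩`. [folklore] -/
def reindex (γ : G ≃g G) : Idx V ≃ Idx V := Equiv.sigmaCongrRight fun _ => isoImageEquiv γ

/-- `reindex γ ⟨n, C⟩ = ⟨n, γ · C⟩`. [folklore] -/
@[simp] theorem reindex_apply (γ : G ≃g G) (i : Idx V) : reindex γ i = ⟨i.1, isoImage γ i.2⟩ := rfl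

end Coins

/-! ### The percolation: remove the inner boundaries of the activated copies -/

section Config

open MeasureTheory ProbabilityTheory unitInterval

variable [DecidableEq V] [G.LocallyFinite]

variable (G) in
/-- The site configuration determined by the coins `η`: a vertex is open unless it lies on the
inner vertex boundary of an activated copy `C` of some `F n` (activated: `η ⟨n, C⟩ = true`);
cf. `ω_F := V ∖ ⋃_{x ∈ ζ} ∂_V(γ_x F)` and `ω := ⋂_n ω_{F_n}` in
[cite: LyonsPeres2016, Thm. 8.37 (proof)]. [folklore] -/
def config (F : ℕ → Finset V) (η : Idx V → Bool) : Set V :=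
  {v | ∀ n : ℕ, ∀ C : Finset V, C ∈ copies G (F n) → η ⟨n, C⟩ = true → v ∉ innerBoundary G C}

/-- Unfolding lemma for `config`. [folklore] -/
theorem mem_config {F : ℕ → Finset V} {η : Idx V → Bool} {v : V} :
    v ∈ config G F η ↔
      ∀ n : ℕ, ∀ C : Finset V, C ∈ copies G (F n) → η ⟨n, C⟩ = true → v ∉ innerBoundary G C :=
  Iff.rfl

/-- `config` is measurable (countably many measurable conditions on coordinates). [folklore] -/
theorem measurable_config [Countable V] (F : ℕ → Finset V) : Measurable (config G F) := by
  refine measurable_set_iff.2 fun v => ?_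
  simp only [mem_config]
  refine Measurable.forall fun n => Measurable.forall fun C =>
    Measurable.imp measurable_const (Measurable.imp ?_ measurable_const)
  exact (measurable_pi_apply _).eq_const _

/-- Equivariance of `config` under re-indexing the coins by an automorphism. [folklore] -/
theorem mem_config_comp_reindex {F : ℕ → Finset V} {η : Idx V → Bool} (γ : G ≃g G) {v : V} :
    v ∈ config G F (η ∘ ⇑(reindex γ.symm)) ↔ γ.symm v ∈ config G F η := by
  simp only [mem_config, Function.comp_apply, reindex_apply]
  constructor
  · intro h n C hC hη hv
    refine h n (isoImage γ C) (isoImage_mem_copies γ hC) (by simpa using hη) ?_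
    rw [innerBoundary_isoImage, mem_isoImage]
    exact hv
  · intro h n C hC hη hv
    refine h n (isoImage γ.symm C) (isoImage_mem_copies γ.symm hC) hη ?_
    rw [innerBoundary_isoImage, mem_isoImage]
    simpa using hv

/-- `γ '' config η = config (η ∘ reindex γ⁻¹)`: automorphisms act on configurations by
re-indexing the coins. [folklore] -/
theorem image_config (F : ℕ → Finset V) (γ : G ≃g G) (η : Idx V → Bool) :
    (γ : V → V) '' config G F η = config G F (η ∘ ⇑(reindex γ.symm)) := by
  ext v
  rw [mem_config_comp_reindex, Set.mem_image]
  constructor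
  · rintro ⟨w, hw, rfl⟩
    simpa using hw
  · intro h
    exact ⟨γ.symm v, h, γ.apply_symm_apply v⟩

omit [DecidableEq V] [G.LocallyFinite] in
/-- Taking the image under an automorphism is a measurable self-map of `Set V`. [folklore] -/
theorem measurable_image_iso (γ : G ≃g G) : Measurable fun ω : Set V => (γ : V → V) '' ω := by
  refine measurable_set_iff.2 fun v => ?_
  have : (fun ω : Set V => v ∈ (γ : V → V) '' ω) = fun ω => γ.symm v ∈ ω := by
    funext ω
    apply propext
    constructor
    · rintro ⟨w, hw, hwv⟩
      have : w = γ.symm v := by rw [← hwv]; simp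
      exact this ▸ hw
    · intro h
      exact ⟨γ.symm v, h, γ.apply_symm_apply v⟩
  rw [this]
  exact measurable_set_mem _

variable (G) in
/-- The law of `config`: push-forward of the coin measure. [folklore] -/
noncomputable def perc (F : ℕ → Finset V) (q : ℕ → I) : Measure (Set V) :=
  (coinMeasure q).map (config G F)

/-- The law of `config` is a probability measure (`V` countable). [folklore] -/
instance instIsProbabilityMeasurePerc [Countable V] (F : ℕ → Finset V) (q : ℕ → I) :
    IsProbabilityMeasure (perc G F q) :=
  Measure.isProbabilityMeasure_map (measurable_config F).aemeasurable

/-- **Automorphism invariance** of the law of `config`. [folklore] -/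
theorem perc_preimage_image [Countable V] (F : ℕ → Finset V) (q : ℕ → I) (γ : G ≃g G)
    {A : Set (Set V)} (hA : MeasurableSet A) :
    perc G F q ((fun ω : Set V => (γ : V → V) '' ω) ⁻¹' A) = perc G F q A := by
  have hm := measurable_config (G := G) F
  have hcomp : Measurable fun η : Idx V → Bool => η ∘ ⇑(reindex γ.symm) :=
    measurable_pi_lambda _ fun i => measurable_pi_apply _
  rw [perc, Measure.map_apply hm (measurable_image_iso γ hA), Measure.map_apply hm hA,
    ← Set.preimage_comp]
  have : (fun ω : Set V => (γ : V → V) '' ω) ∘ config G F =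
      config G F ∘ fun η : Idx V → Bool => η ∘ ⇑(reindex γ.symm) :=
    funext (image_config F γ)
  rw [this, Set.preimage_comp, ← Measure.map_apply hcomp (hm hA),
    coinMeasure_map_comp_equiv q _ (fun i => rfl)]

/-- The law of `config` is an invariant site percolation (for every choice of the sets `F n` and
of the activation probabilities `q n`). [folklore] -/
theorem isInvariantSitePercolation_perc [Countable V] (F : ℕ → Finset V) (q : ℕ → I) :
    IsInvariantSitePercolation G (perc G F q) :=
  ⟨inferInstance, fun γ _ hA => perc_preimage_image F q γ hA⟩

end Config

/-! ### Estimates: density and finiteness of clusters -/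

section Estimates

open MeasureTheory ProbabilityTheory unitInterval

variable [DecidableEq V] [G.LocallyFinite]

/-- `P[x closed] ≤ Σ_n q_n · #{copies C of F_n with x ∈ ∂_in C}`; cf. (8.23) in
[cite: LyonsPeres2016, Thm. 8.37 (proof)]. [folklore] -/
theorem coinMeasure_not_mem_config_le (F : ℕ → Finset V) (q : ℕ → I) (x : V)
    (B : ℕ → Finset (Finset V))
    (hB : ∀ n C, C ∈ copies G (F n) → x ∈ innerBoundary G C → C ∈ B n) :
    coinMeasure q {η | x ∉ config G F η} ≤ ∑' n, ((B n).card : ENNReal) * toNNReal (q n) := by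
  have hsub : {η : Idx V → Bool | x ∉ config G F η} ⊆ ⋃ n, ⋃ C ∈ B n, {η | η ⟨n, C⟩ = true} := by
    intro η hη
    rw [Set.mem_setOf_eq, mem_config] at hη
    push Not at hη
    obtain ⟨n, C, hC, hη, hx⟩ := hη
    simp only [Set.mem_iUnion, Set.mem_setOf_eq, exists_prop]
    exact ⟨n, C, hB n C hC hx, hη⟩
  calc coinMeasure q {η | x ∉ config G F η}
      ≤ coinMeasure q (⋃ n, ⋃ C ∈ B n, {η | η ⟨n, C⟩ = true}) := measure_mono hsub
    _ ≤ ∑' n, coinMeasure q (⋃ C ∈ B n, {η | η ⟨n, C⟩ = true}) := measure_iUnion_le _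
    _ ≤ ∑' n, ∑ C ∈ B n, coinMeasure q {η | η ⟨n, C⟩ = true} :=
        ENNReal.tsum_le_tsum fun n => measure_biUnion_finset_le _ _
    _ = ∑' n, ((B n).card : ENNReal) * toNNReal (q n) := by
        refine tsum_congr fun n => ?_
        have h : ∀ C ∈ B n, coinMeasure q {η : Idx V → Bool | η ⟨n, C⟩ = true} = toNNReal (q n) :=
          fun C _ => coinMeasure_eval_true q ⟨n, C⟩
        rw [Finset.sum_congr rfl h, Finset.sum_const, nsmul_eq_mul]

variable (G) in
/-- The event "every vertex lies in a finite set whose inner vertex boundary is closed"; on it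
all open site clusters are finite. [folklore] -/
def goodEvent : Set (Set V) :=
  {ω | ∀ x : V, ∃ C : Finset V, x ∈ C ∧ ∀ v ∈ innerBoundary G C, v ∉ ω}

/-- `goodEvent` is measurable (`V` countable). [folklore] -/
theorem measurableSet_goodEvent [Countable V] : MeasurableSet (goodEvent G) := by
  unfold goodEvent
  exact measurableSet_setOf.2 (Measurable.forall fun x => Measurable.exists fun C =>
    Measurable.and measurable_const (Measurable.forall fun v =>
      Measurable.imp measurable_const (measurable_set_notMem v)))

/-- On `goodEvent` every open site cluster is finite. [folklore] -/
theorem finite_siteCluster_of_mem_goodEvent {ω : Set V} (h : ω ∈ goodEvent G) (x : V) :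
    (siteCluster G ω x).Finite := by
  obtain ⟨C, hx, hC⟩ := h x
  exact C.finite_toSet.subset (siteCluster_subset_of_innerBoundary_closed ω C hC hx)

/-- If every vertex lies in an activated copy then `config η ∈ goodEvent`. [folklore] -/
theorem config_mem_goodEvent {F : ℕ → Finset V} {η : Idx V → Bool}
    (h : ∀ x, ∃ n C, C ∈ through G (F n) x ∧ η ⟨n, C⟩ = true) : config G F η ∈ goodEvent G := by
  intro x
  obtain ⟨n, C, ⟨hC, hxC⟩, hη⟩ := h x
  exact ⟨C, hxC, fun v hv hvω => (mem_config.1 hvω) n C hC hη hv⟩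

end Estimates

/-! ### Theorem 8.37 (amenable ⟹ invariant finite-cluster percolations of density → 1) -/

section Main

open MeasureTheory ProbabilityTheory unitInterval Filter Topology

/-- **Discharge of the barrier `AmenableInvariantPercolation`** [cite: LyonsPeres2016, Thm. 8.37]
(direction "amenable ⟹", transitive connected locally finite `G`). The proof follows the book
(pp. 412–413): remove the (inner vertex) boundaries of randomly activated copies of larger and
larger Følner sets `F_n`, placed more and more rarely (activation probability `1/N_n`, `N_n` =
number of copies of `F_n` through a vertex), independently over `n`; the Haar-random
automorphisms `γ_x` of the book are replaced by independent coins on the countable set of all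
copies `γ F_n`, and the mass-transport identity (8.25) by Følner double counting
(`amenable_double_count`), so neither Haar measure nor unimodularity (Prop. 8.14) is needed.
(8.23) becomes `P[x ∉ ω] ≤ Σ_n |∂_E F_n|/|F_n| < 1 - α`, and (8.24) becomes
`P[no activated copy of F_n contains x for all n < m] ≤ e^{-m}`. -/
theorem AmenableInvariantPercolation_holds : AmenableInvariantPercolation := by
  intro V _ G _ hc ht ha α hα
  classical
  haveI : Countable V := countable_of_connected hc
  obtain ⟨o⟩ := hc.nonempty
  -- the budget `δ = 1 - α`, split as `ε n = δ / 2^(n+2)`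
  set δ : ℝ := 1 - α with hδ
  have hδpos : 0 < δ := by rw [hδ]; linarith
  set ε : ℕ → ℝ := fun n => δ / 2 / 2 / 2 ^ n with hε
  have hεpos : ∀ n, 0 < ε n := fun n => by positivity
  -- Følner sets `F n` with `|∂_E F n| ≤ ε n |F n|`
  choose F hFne hFbd using fun n => ha (ε n) (hεpos n)
  -- `N n` = number of copies of `F n` through a vertex (independent of the vertex)
  set N : ℕ → ℕ := fun n => (through G (F n) o).ncard with hN
  have hNx : ∀ n x, (through G (F n) x).ncard = N n := fun n x => ncard_through_eq ht (F n) x o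
  have hNpos : ∀ n, 0 < N n := fun n =>
    (Set.ncard_pos (through_finite hc (F n) o)).2 (through_nonempty ht (hFne n) o)
  -- activation probabilities `q n = 1 / N n`
  set q : ℕ → I := fun n => ⟨((N n : ℝ))⁻¹, by positivity, Nat.cast_inv_le_one (N n)⟩ with hq
  have hqcoe : ∀ n, (q n : ℝ) = ((N n : ℝ))⁻¹ := fun n => rfl
  have hmeas := measurable_config (G := G) F
  refine ⟨perc G F q, isInvariantSitePercolation_perc F q, ?_, ?_⟩
  · /- finite clusters almost surely -/
    set T : ℕ → V → Finset (Finset V) := fun n x => (through_finite hc (F n) x).toFinset with hT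
    have hTmem : ∀ n x C, C ∈ T n x ↔ C ∈ through G (F n) x := fun n x C =>
      Set.Finite.mem_toFinset _
    have hTcard : ∀ n x, (T n x).card = N n := fun n x => by
      rw [← hNx n x, Set.ncard_eq_toFinset_card _ (through_finite hc (F n) x)]
    -- for each vertex, "no activated copy through x at any level" is a null event
    have hnull : ∀ x,
        coinMeasure q {η : Idx V → Bool | ∀ n, ∀ C ∈ T n x, η ⟨n, C⟩ = false} = 0 := by
      intro x
      set c : ENNReal := ENNReal.ofReal (Real.exp (-1)) with hc'
      have hc1 : c < 1 := ENNReal.ofReal_lt_one.2 (Real.exp_lt_one_iff.2 (by norm_num))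
      have hbound : ∀ m,
          coinMeasure q {η : Idx V → Bool | ∀ n, ∀ C ∈ T n x, η ⟨n, C⟩ = false} ≤ c ^ m := by
        intro m
        refine (coinMeasure_forall_eq_false_le q (fun n => T n x) m).trans ?_
        calc ∏ n ∈ Finset.range m, (toNNReal (σ (q n)) : ENNReal) ^ (T n x).card
            ≤ ∏ n ∈ Finset.range m, c := Finset.prod_le_prod (fun _ _ => zero_le) fun n _ => ?_
          _ = c ^ m := by simp
        rw [hTcard]
        have hq1 : (toNNReal (σ (q n)) : ENNReal) = ENNReal.ofReal (1 - ((N n : ℝ))⁻¹) := by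
          rw [← ENNReal.ofReal_coe_nnreal, coe_toNNReal, coe_symm_eq, hqcoe]
        rw [hq1, ← ENNReal.ofReal_pow (sub_nonneg.2 (Nat.cast_inv_le_one _))]
        refine ENNReal.ofReal_le_ofReal ?_
        have hN0 : (N n : ℝ) ≠ 0 := by exact_mod_cast (hNpos n).ne'
        calc (1 - ((N n : ℝ))⁻¹) ^ N n ≤ (Real.exp (-((N n : ℝ))⁻¹)) ^ N n :=
              pow_le_pow_left₀ (sub_nonneg.2 (Nat.cast_inv_le_one _)) (Real.one_sub_le_exp_neg _) _
          _ = Real.exp (-1) := by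
              rw [← Real.exp_nat_mul]
              congr 1
              field_simp
      have htend : Tendsto (fun m => c ^ m) atTop (𝓝 0) :=
        ENNReal.tendsto_pow_atTop_nhds_zero_iff.2 hc1
      exact le_antisymm (ge_of_tendsto' htend hbound) zero_le
    -- hence a.s. every vertex lies in an activated copy
    have hW : ∀ᵐ η ∂coinMeasure q, ∀ x, ∃ n C, C ∈ through G (F n) x ∧ η ⟨n, C⟩ = true := by
      rw [ae_iff]
      refine measure_mono_null ?_ (measure_iUnion_null hnull)
      intro η hη
      rw [Set.mem_setOf_eq] at hη
      push Not at hη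
      obtain ⟨x, hx⟩ := hη
      simp only [Set.mem_iUnion, Set.mem_setOf_eq]
      refine ⟨x, fun n C hC => ?_⟩
      simpa using hx n C ((hTmem n x C).1 hC)
    have hWg : ∀ᵐ η ∂coinMeasure q, config G F η ∈ goodEvent G :=
      hW.mono fun η hη => config_mem_goodEvent hη
    have hpre : coinMeasure q (config G F ⁻¹' goodEvent G) = 1 := by
      rw [← prob_compl_eq_zero_iff (hmeas measurableSet_goodEvent)]
      rw [ae_iff] at hWg
      exact hWg
    have hperc : ∀ᵐ ω ∂perc G F q, ω ∈ goodEvent G := by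
      rw [Filter.Eventually, mem_ae_iff, Set.setOf_mem_eq,
        prob_compl_eq_zero_iff measurableSet_goodEvent, perc,
        Measure.map_apply hmeas measurableSet_goodEvent]
      exact hpre
    exact hperc.mono fun ω hω x => finite_siteCluster_of_mem_goodEvent hω x
  · /- density -/
    intro x
    have hmeasS : MeasurableSet {ω : Set V | x ∈ ω} := measurableSet_mem x
    have hBfin : ∀ n, (bthrough G (F n) x).Finite := fun n =>
      (through_finite hc (F n) x).subset (bthrough_subset_through _ _)
    set B : ℕ → Finset (Finset V) := fun n => (hBfin n).toFinset with hB
    have hBmem : ∀ n C, C ∈ copies G (F n) → x ∈ innerBoundary G C → C ∈ B n :=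
      fun n C hC hx => (Set.Finite.mem_toFinset _).2 ⟨hC, hx⟩
    -- (8.23): `#B n · q n ≤ |∂_E F n| / |F n| ≤ ε n`
    have hBcard : ∀ n, ((B n).card : ℝ) * (q n : ℝ) ≤ ε n := by
      intro n
      have h1 := ncard_bthrough_mul_card_le hc ht ha (F n) x
      rw [hNx n x] at h1
      have hcardB : (B n).card = (bthrough G (F n) x).ncard :=
        (Set.ncard_eq_toFinset_card _ (hBfin n)).symm
      have hFpos : (0 : ℝ) < (F n).card := by exact_mod_cast (hFne n).card_pos
      have hNpos' : (0 : ℝ) < N n := by exact_mod_cast hNpos n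
      have h2 : ((bthrough G (F n) x).ncard : ℝ) * (F n).card ≤ (N n * ε n) * (F n).card := by
        calc ((bthrough G (F n) x).ncard : ℝ) * (F n).card
            ≤ N n * (edgeBoundary G (F n)).card := by exact_mod_cast h1
          _ ≤ N n * (ε n * (F n).card) := by gcongr; exact hFbd n
          _ = (N n * ε n) * (F n).card := by ring
      have h3 : ((bthrough G (F n) x).ncard : ℝ) ≤ N n * ε n := le_of_mul_le_mul_right h2 hFpos
      rw [hcardB, hqcoe, mul_inv_le_iff₀ hNpos', mul_comm (ε n)]
      exact h3
    -- hence `P[x closed] ≤ δ / 2`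
    have hbad : coinMeasure q {η | x ∉ config G F η} ≤ ENNReal.ofReal (δ / 2) := by
      calc coinMeasure q {η | x ∉ config G F η}
          ≤ ∑' n, ((B n).card : ENNReal) * toNNReal (q n) :=
            coinMeasure_not_mem_config_le F q x B hBmem
        _ ≤ ∑' n, ENNReal.ofReal (ε n) := by
            refine ENNReal.tsum_le_tsum fun n => ?_
            have : ((B n).card : ENNReal) * toNNReal (q n) =
                ENNReal.ofReal (((B n).card : ℝ) * (q n : ℝ)) := by
              rw [ENNReal.ofReal_mul (Nat.cast_nonneg _), ENNReal.ofReal_natCast,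
                ← ENNReal.ofReal_coe_nnreal, coe_toNNReal]
            rw [this]
            exact ENNReal.ofReal_le_ofReal (hBcard n)
        _ = ENNReal.ofReal (∑' n, ε n) :=
            (ENNReal.ofReal_tsum_of_nonneg (fun n => (hεpos n).le) (summable_geometric_two' _)).symm
        _ = ENNReal.ofReal (δ / 2) := by rw [hε, tsum_geometric_two']
    have hcomplS : MeasurableSet {η : Idx V → Bool | x ∉ config G F η} := (hmeas hmeasS).compl
    have hgood :
        coinMeasure q {η | x ∈ config G F η} = 1 - coinMeasure q {η | x ∉ config G F η} := by
      rw [← prob_compl_eq_one_sub hcomplS]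
      congr 1
      ext η
      simp only [Set.mem_setOf_eq, Set.mem_compl_iff, not_not]
    rw [measureReal_def, perc, Measure.map_apply hmeas hmeasS]
    change α < (coinMeasure q {η | x ∈ config G F η}).toReal
    rw [hgood, ENNReal.toReal_sub_of_le prob_le_one ENNReal.one_ne_top, ENNReal.toReal_one]
    have : (coinMeasure q {η | x ∉ config G F η}).toReal ≤ δ / 2 :=
      ENNReal.toReal_le_of_le_ofReal (by positivity) hbad
    rw [hδ] at this
    linarith

end Main

end Literature.Barriers.CriticalPhenomena
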